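import Literature.Analysis.Hypoelliptic.ShadowConv
import Literature.Analysis.Hypoelliptic.FourierSupBound
import HarnessLib

/-!
# Schwartz adjoints of symbolic operators and the a.e. vanishing principle

Analysis/Hypoelliptic support file serving the discharge of
`Literature.Analysis.Distribution.Hormander1967_thm11` (used to establish the Fourier-side
spanning hypothesis `HData.SpanHyp` from Hörmander's bracket condition).

For the sub-syntax `Sym.Good` of symbolic operators generated by `lin v`, `cmul c`,
`conv θ_b` (`θ_b = conj ∘ 𝓕 b`, `b` Schwartz), `smul`, `add`, `comp`:

* `Sym.dx s`: the corresponding differential operator on functions of the Fourier-transformed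
  Schwartz side (`lin v ↦ ∂_v`, `conv θ_b ↦ (b ·)`, `cmul c ↦ (conj c ·)`, composition
  reversed);
* **Schwartz adjoints** (`Sym.Good.sadj`): there is `S† : 𝓢 → 𝓢` with
  `pairing (s F) ψ = pairing F (S† ψ)` for `F ∈ Nice` and `𝓕 (S† ψ) = s.dx (𝓕 ψ)`;
* **a.e. vanishing** (`Sym.Good.apply_ae_eq`): if `s₁.dx = s₂.dx` on Fourier transforms of
  Schwartz functions then `s₁ F =ᵐ s₂ F` for `F ∈ Nice`;
* **continuity of convolutions** (`continuous_kerOp_convKer_thetaOf`): `conv θ_b H` is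
  continuous for `H ∈ Ĥ^t` — used to upgrade a.e. identities headed by convolutions to
  pointwise ones.

## References

* L. Hörmander, *The Analysis of Linear Partial Differential Operators I*, §7.1 (folklore).
-/

noncomputable section

open MeasureTheory Set Filter Function SchwartzMap
open scoped ENNReal NNReal Topology ComplexConjugate InnerProductSpace FourierTransform BigOperators

namespace Literature.Analysis.Hypoelliptic

variable {V : Type*} [NormedAddCommGroup V] [InnerProductSpace ℝ V] [FiniteDimensional ℝ V]
  [MeasurableSpace V] [BorelSpace V]

namespace Sym

/-! ### The good sub-syntax and its differential operators -/

/-- The sub-syntax with Schwartz adjoints: linear symbols, constants, convolutions by `θ_b`,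
and their scalar multiples, sums and compositions. [folklore] -/
inductive Good : Sym V → Prop
  | lin (v : V) : Good (lin v)
  | cmul (c : ℂ) : Good (cmul c)
  | conv (b : 𝓢(V, ℂ)) : Good (conv (thetaOf b))
  | smul (c : ℂ) {s : Sym V} : Good s → Good (smul c s)
  | add {s t : Sym V} : Good s → Good t → Good (add s t)
  | comp {s t : Sym V} : Good s → Good t → Good (comp s t)

/-- Good expressions are certified. [folklore] -/
theorem Good.cert {s : Sym V} (hs : Good s) : Cert s := by
  induction hs with
  | lin v => trivial
  | cmul c => trivial
  | conv b => exact ⟨_, rapidDecay_thetaOf b⟩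
  | smul c _ ih => exact ih
  | add _ _ ih ih' => exact ⟨ih, ih'⟩
  | comp _ _ ih ih' => exact ⟨ih, ih'⟩

/-- **The differential operator of a symbolic operator** on the Fourier-transformed Schwartz
side (`lin v ↦ ∂_v`, `conv θ ↦ (𝓕⁻¹(conj θ) ·)`, `cmul c ↦ (conj c ·)`, composition reversed;
junk on the gain primitives). [folklore] -/
def dx : Sym V → (V → ℂ) → (V → ℂ)
  | bessel _, g => g
  | lin v, g => fun y => fderiv ℝ g y v
  | cmul c, g => fun y => conj c * g y
  | conv θ, g => fun y => 𝓕⁻ (fun ζ => conj (θ ζ)) y * g y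
  | gcomm1 _ _, g => g
  | gcomm2 _ _ _, g => g
  | smul c s, g => fun y => conj c * dx s g y
  | add s t, g => fun y => dx s g y + dx t g y
  | comp s t, g => dx t (dx s g)

/-- (structural lemma) [folklore] -/
@[simp] theorem dx_lin (v : V) (g : V → ℂ) : dx (lin v) g = fun y => fderiv ℝ g y v := rfl
/-- (structural lemma) [folklore] -/
@[simp] theorem dx_cmul (c : ℂ) (g : V → ℂ) : dx (cmul c) g = fun y => conj c * g y := rfl
/-- (structural lemma) [folklore] -/
@[simp] theorem dx_smul (c : ℂ) (s : Sym V) (g : V → ℂ) :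
    dx (smul c s) g = fun y => conj c * dx s g y := rfl
/-- (structural lemma) [folklore] -/
@[simp] theorem dx_add (s t : Sym V) (g : V → ℂ) :
    dx (add s t) g = fun y => dx s g y + dx t g y := rfl
/-- (structural lemma) [folklore] -/
@[simp] theorem dx_comp (s t : Sym V) (g : V → ℂ) : dx (comp s t) g = dx t (dx s g) := rfl

/-- `dx (conv θ_b) g = b · g`. [folklore] -/
@[simp] theorem dx_conv_thetaOf (b : 𝓢(V, ℂ)) (g : V → ℂ) :
    dx (conv (thetaOf b)) g = fun y => b y * g y := by
  ext y
  simp only [dx, thetaOf, Complex.conj_conj]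
  congr 1
  have h : (fun ζ => 𝓕 (b : V → ℂ) ζ) = 𝓕 (b : V → ℂ) := rfl
  rw [h, ← SchwartzMap.fourier_coe, ← SchwartzMap.fourierInv_coe, FourierTransform.fourierInv_fourier_eq]

/-! ### Schwartz adjoints -/

/-- **Schwartz adjoints of good expressions.** [folklore] -/
theorem Good.sadj {s : Sym V} (hs : Good s) :
    ∃ Sd : 𝓢(V, ℂ) → 𝓢(V, ℂ),
      (∀ ψ : 𝓢(V, ℂ), ((𝓕 (Sd ψ) : 𝓢(V, ℂ)) : V → ℂ) = s.dx ((𝓕 ψ : 𝓢(V, ℂ)) : V → ℂ)) ∧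
      ∀ (F : V → ℂ), Nice F → ∀ ψ : 𝓢(V, ℂ), pairing (apply s F) ψ = pairing F (Sd ψ) := by
  induction hs with
  | lin v =>
    refine ⟨fun ψ => -(linSchwartz v ψ), fun ψ => ?_, fun F hF ψ => ?_⟩
    · ext y
      rw [show 𝓕 (-(linSchwartz v ψ)) = -𝓕 (linSchwartz v ψ) from
        (SchwartzMap.fourierTransformCLM ℂ).map_neg _]
      rw [neg_apply, fourier_linSchwartz_apply, neg_neg, dx_lin, SchwartzMap.fourier_coe]
    · rw [apply_lin, pairing_mul_left]
      congr 1
      ext ξ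
      rw [conj_linMul, neg_apply, linSchwartz_apply]
      ring
  | cmul c =>
    refine ⟨fun ψ => (conj c) • ψ, fun ψ => ?_, fun F hF ψ => ?_⟩
    · ext y
      show ((𝓕 ((conj c) • ψ) : 𝓢(V, ℂ)) : V → ℂ) y = _
      rw [show (𝓕 ((conj c) • ψ) : 𝓢(V, ℂ)) = (conj c) • 𝓕 ψ from
        (SchwartzMap.fourierTransformCLM ℂ).map_smul (conj c) ψ]
      simp [dx]
    · rw [apply_cmul, pairing_const_mul_left]
      rw [show (((conj c) • ψ : 𝓢(V, ℂ)) : V → ℂ) = fun ξ => conj c * ψ ξ from by ext; simp,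
        pairing_const_mul_right, Complex.conj_conj]
  | conv b =>
    refine ⟨fun ψ => mulFourier b ψ, fun ψ => ?_, fun F hF ψ => ?_⟩
    · ext y
      have e2 : 𝓕 (mulFourier b ψ) = SchwartzMap.smulLeftCLM ℂ (b : V → ℂ) (𝓕 ψ) := by
        unfold mulFourier
        simp only [ContinuousLinearMap.coe_comp, ContinuousLinearEquiv.coe_coe, Function.comp_apply,
          FourierTransform.fourierCLE_apply]
        exact (FourierTransform.fourierCLE ℂ (𝓢(V, ℂ))).apply_symm_apply _
      rw [e2, SchwartzMap.smulLeftCLM_apply_apply b.hasTemperateGrowth, dx_conv_thetaOf, smul_eq_mul]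
    · have hK := (rapidDecay_thetaOf b).kerDecay_convKer
      have hψ := SchwartzMap.nice ψ
      rw [apply_conv, hK.pairing_kerOp_left (hF.inH 0) (hψ.inH _)]
      congr 1
      ext ξ
      exact kerOp_adjKer_convKer_thetaOf b ψ ξ
  | smul c _ ih =>
    obtain ⟨Sd, hSf, hSp⟩ := ih
    refine ⟨fun ψ => (conj c) • Sd ψ, fun ψ => ?_, fun F hF ψ => ?_⟩
    · ext y
      show ((𝓕 ((conj c) • Sd ψ) : 𝓢(V, ℂ)) : V → ℂ) y = _
      rw [show (𝓕 ((conj c) • Sd ψ) : 𝓢(V, ℂ)) = (conj c) • 𝓕 (Sd ψ) from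
        (SchwartzMap.fourierTransformCLM ℂ).map_smul (conj c) (Sd ψ)]
      simp only [smul_apply, smul_eq_mul, dx_smul]
      rw [← hSf ψ]
    · rw [apply_smul, pairing_const_mul_left, hSp F hF ψ,
        show (((conj c) • Sd ψ : 𝓢(V, ℂ)) : V → ℂ) = fun ξ => conj c * Sd ψ ξ from by ext; simp,
        pairing_const_mul_right, Complex.conj_conj]
  | add hs ht ih ih' =>
    obtain ⟨Sd, hSf, hSp⟩ := ih
    obtain ⟨Td, hTf, hTp⟩ := ih'
    refine ⟨fun ψ => Sd ψ + Td ψ, fun ψ => ?_, fun F hF ψ => ?_⟩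
    · ext y
      show ((𝓕 (Sd ψ + Td ψ) : 𝓢(V, ℂ)) : V → ℂ) y = _
      rw [show (𝓕 (Sd ψ + Td ψ) : 𝓢(V, ℂ)) = 𝓕 (Sd ψ) + 𝓕 (Td ψ) from
        (SchwartzMap.fourierTransformCLM ℂ).map_add _ _]
      simp only [add_apply, dx_add]
      rw [← hSf ψ, ← hTf ψ]
    · have hψS := SchwartzMap.nice (Sd ψ)
      have hψT := SchwartzMap.nice (Td ψ)
      rw [apply_add, pairing_add_left ((hs.cert.nice_apply hF).inH 0) ((ht.cert.nice_apply hF).inH 0)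
        ((SchwartzMap.nice ψ).inH _), hSp F hF ψ, hTp F hF ψ,
        show (((Sd ψ + Td ψ : 𝓢(V, ℂ))) : V → ℂ) = fun ξ => Sd ψ ξ + Td ψ ξ from by ext; simp,
        pairing_add_right (hF.inH 0) (hψS.inH _) (hψT.inH _)]
  | comp hs ht ih ih' =>
    obtain ⟨Sd, hSf, hSp⟩ := ih
    obtain ⟨Td, hTf, hTp⟩ := ih'
    refine ⟨fun ψ => Td (Sd ψ), fun ψ => ?_, fun F hF ψ => ?_⟩
    · rw [hTf (Sd ψ), hSf ψ, dx_comp]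
    · rw [apply_comp, hSp _ (ht.cert.nice_apply hF) ψ, hTp F hF (Sd ψ)]

/-- **The a.e. vanishing principle**: two good expressions whose differential operators agree
on Fourier transforms of Schwartz functions act identically a.e. on `Nice`. [folklore] -/
theorem Good.apply_ae_eq {s₁ s₂ : Sym V} (h₁ : Good s₁) (h₂ : Good s₂)
    (hdx : ∀ ψ : 𝓢(V, ℂ), s₁.dx ((𝓕 ψ : 𝓢(V, ℂ)) : V → ℂ) = s₂.dx ((𝓕 ψ : 𝓢(V, ℂ)) : V → ℂ))
    {F : V → ℂ} (hF : Nice F) : apply s₁ F =ᵐ[volume] apply s₂ F := by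
  obtain ⟨S₁, hS₁f, hS₁p⟩ := h₁.sadj
  obtain ⟨S₂, hS₂f, hS₂p⟩ := h₂.sadj
  refine ae_eq_of_forall_pairing_schwartz ((h₁.cert.nice_apply hF).inH 0) ((h₂.cert.nice_apply hF).inH 0)
    fun ψ => ?_
  rw [hS₁p F hF ψ, hS₂p F hF ψ]
  -- `𝓕 (S₁ ψ) = 𝓕 (S₂ ψ)`, hence `S₁ ψ = S₂ ψ`
  have hF12 : (𝓕 (S₁ ψ) : 𝓢(V, ℂ)) = 𝓕 (S₂ ψ) := by
    ext y
    have := congrFun (hS₁f ψ) y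
    rw [this, hdx ψ, ← congrFun (hS₂f ψ) y]
  have h12 : S₁ ψ = S₂ ψ :=
    (FourierTransform.fourierCLE ℂ (𝓢(V, ℂ))).injective
      (by simpa [FourierTransform.fourierCLE_apply] using hF12)
  rw [h12]

end Sym

/-! ### Continuity of convolutions by `θ_b` -/

/-- `η ↦ ⟨ξ₀ - η⟩^{-N} ‖G η‖` is integrable for `G ∈ Ĥ^t` and `N` large. [folklore] -/
theorem integrable_bw_shift_mul_norm {t : ℝ} {G : V → ℂ} (hG : InH t G) {N : ℕ}
    (hN : (Module.finrank ℝ V : ℝ) < 2 * (t + N)) (ξ₀ : V) :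
    Integrable (fun η : V => bw (-N) (ξ₀ - η) * ‖G η‖) (volume : Measure V) := by
  -- Peetre: `⟨ξ₀ - η⟩^{-N} ≤ 2^{N/2} ⟨ξ₀⟩^N ⟨η⟩^{-N}`
  have hP : ∀ η : V, bw (-N) (ξ₀ - η) ≤ 2 ^ ((N : ℝ) / 2) * bw N ξ₀ * bw (-N) η := by
    intro η
    have h := peetre (-(N : ℝ)) (-η) ξ₀
    rw [show -η + ξ₀ = ξ₀ - η by abel, bw_neg_arg, abs_neg, Nat.abs_cast] at h
    calc bw (-N) (ξ₀ - η) ≤ 2 ^ ((N : ℝ) / 2) * bw (-N) η * bw N ξ₀ := h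
      _ = _ := by ring
  have hm : AEStronglyMeasurable (fun η : V => bw (-N) (ξ₀ - η) * ‖G η‖) volume :=
    ((continuous_bw (-(N : ℝ))).comp (continuous_const.sub continuous_id)).aestronglyMeasurable.mul
      hG.1.norm
  -- the dominating function `2^{N/2} ⟨ξ₀⟩^N ⟨η⟩^{-N} ‖G η‖` is integrable by Cauchy–Schwarz
  have hdom : Integrable (fun η : V => 2 ^ ((N : ℝ) / 2) * bw N ξ₀ * (bw (-N) η * ‖G η‖)) volume := by
    refine Integrable.const_mul ?_ _
    refine ⟨(continuous_bw _).aestronglyMeasurable.mul hG.1.norm, ?_⟩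
    have h := lintegral_bw_norm_le (-(N : ℝ)) (t + N) hG.1
    rw [show -(N : ℝ) + (t + N) = t by ring] at h
    have hfin : decayL2 V (t + N) * wnorm t G < ⊤ := ENNReal.mul_lt_top (decayL2_lt_top hN) hG.2
    refine lt_of_le_of_lt (lintegral_mono fun η => ?_) (h.trans_lt hfin)
    rw [← ofReal_norm, Real.norm_of_nonneg (mul_nonneg (bw_nonneg _ _) (norm_nonneg _))]
  refine hdom.mono' hm (Eventually.of_forall fun η => ?_)
  rw [Real.norm_of_nonneg (mul_nonneg (bw_nonneg _ _) (norm_nonneg _)), ← mul_assoc]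
  exact mul_le_mul_of_nonneg_right (hP η) (norm_nonneg _)

/-- **Convolutions by `θ_b` of functions in `Ĥ^t` are continuous.** [folklore] -/
theorem continuous_kerOp_convKer_thetaOf (b : 𝓢(V, ℂ)) {t : ℝ} {G : V → ℂ} (hG : InH t G) :
    Continuous (kerOp (convKer (thetaOf b)) G) := by
  have hθ := rapidDecay_thetaOf b
  -- decay index
  obtain ⟨N, hN⟩ : ∃ N : ℕ, (Module.finrank ℝ V : ℝ) < 2 * (t + N) := by
    obtain ⟨N, hN⟩ := exists_nat_gt ((Module.finrank ℝ V : ℝ) / 2 - t)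
    exact ⟨N, by linarith⟩
  set D : ℝ := (2 : ℝ) ^ N * (Finset.Iic (N, 0)).sup (fun m => SchwartzMap.seminorm ℂ m.1 m.2) (𝓕 b)
    with hD
  have hθb : ∀ ζ, ‖thetaOf b ζ‖ ≤ D * bw (-N) ζ := fun ζ => hθ.bound N ζ
  have hD0 : 0 ≤ D := hθ.nonneg N
  have hθc : Continuous (thetaOf b) := by
    unfold thetaOf
    refine Complex.continuous_conj.comp ?_
    rw [← SchwartzMap.fourier_coe]; exact (𝓕 b).continuous
  refine continuous_iff_continuousAt.2 fun ξ₀ => ?_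
  unfold kerOp convKer
  refine MeasureTheory.continuousAt_of_dominated (bound := fun η => D * 2 ^ (N : ℝ) * (bw (-N) (ξ₀ - η) * ‖G η‖))
    (Eventually.of_forall fun ξ => ?_) ?_ ?_ (Eventually.of_forall fun η => ?_)
  · exact ((hθc.comp (continuous_const.sub continuous_id)).aestronglyMeasurable).mul hG.1
  · -- the bound on `ball ξ₀ 1`
    have hball : ∀ᶠ ξ in 𝓝 ξ₀, ‖ξ - ξ₀‖ ≤ 1 := by
      have : Metric.closedBall ξ₀ 1 ∈ 𝓝 ξ₀ := Metric.closedBall_mem_nhds ξ₀ one_pos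
      filter_upwards [this] with ξ hξ
      rwa [Metric.mem_closedBall, dist_eq_norm] at hξ
    filter_upwards [hball] with ξ hξ
    refine Eventually.of_forall fun η => ?_
    rw [norm_mul]
    -- `⟨ξ - η⟩^{-N} ≤ 2^{N/2} ⟨ξ₀ - η⟩^{-N} ⟨ξ₀ - ξ⟩^{N} ≤ 2^N ⟨ξ₀ - η⟩^{-N}`
    have hP := bw_le_bw_mul_bw_sub' (-(N : ℝ)) (ξ₀ - η) (ξ - η)
    rw [show ξ₀ - η - (ξ - η) = ξ₀ - ξ by abel, abs_neg, Nat.abs_cast] at hP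
    have hb1 : bw (N : ℝ) (ξ₀ - ξ) ≤ 2 ^ ((N : ℝ) / 2) := by
      unfold bw
      have h1 : 1 + ‖ξ₀ - ξ‖ ^ 2 ≤ 2 := by
        have : ‖ξ₀ - ξ‖ ≤ 1 := by rw [norm_sub_rev]; exact hξ
        nlinarith [norm_nonneg (ξ₀ - ξ)]
      calc (1 + ‖ξ₀ - ξ‖ ^ 2) ^ ((N : ℝ) / 2) ≤ (2 : ℝ) ^ ((N : ℝ) / 2) :=
            Real.rpow_le_rpow (by positivity) h1 (by positivity)
        _ = _ := rfl
    have hbw : bw (-N) (ξ - η) ≤ 2 ^ (N : ℝ) * bw (-N) (ξ₀ - η) := by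
      calc bw (-N) (ξ - η) ≤ 2 ^ ((N : ℝ) / 2) * bw (-N) (ξ₀ - η) * bw N (ξ₀ - ξ) := hP
        _ ≤ 2 ^ ((N : ℝ) / 2) * bw (-N) (ξ₀ - η) * 2 ^ ((N : ℝ) / 2) :=
            mul_le_mul_of_nonneg_left hb1 (mul_nonneg (by positivity) (bw_nonneg _ _))
        _ = 2 ^ (N : ℝ) * bw (-N) (ξ₀ - η) := by
            rw [show (2 : ℝ) ^ (N : ℝ) = 2 ^ ((N : ℝ) / 2) * 2 ^ ((N : ℝ) / 2) by
              rw [← Real.rpow_add two_pos]; ring_nf]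
            ring
    calc ‖thetaOf b (ξ - η)‖ * ‖G η‖ ≤ D * bw (-N) (ξ - η) * ‖G η‖ :=
          mul_le_mul_of_nonneg_right (hθb _) (norm_nonneg _)
      _ ≤ D * (2 ^ (N : ℝ) * bw (-N) (ξ₀ - η)) * ‖G η‖ :=
          mul_le_mul_of_nonneg_right (mul_le_mul_of_nonneg_left hbw hD0) (norm_nonneg _)
      _ = D * 2 ^ (N : ℝ) * (bw (-N) (ξ₀ - η) * ‖G η‖) := by ring
  · exact (integrable_bw_shift_mul_norm hG hN ξ₀).const_mul _
  · exact ((hθc.comp (continuous_id.sub continuous_const)).mul continuous_const).continuousAt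

end Literature.Analysis.Hypoelliptic
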